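import Summits.QuantumFields.YangMills.Theorems.BalabanUVNodesN08HaarCompatibilityGuardCoreChart
import Summits.QuantumFields.YangMills.Theorems.BalabanUVNodesN08HaarCompatibilityGuardTangentDictionary


/-!
# BalabanUVNodes ∕ N08 — THE CHART CONJUGATE OF THE CORE MAP WITH AN ARBITRARY UNIT TARGET CENTRE, AND THE CENTRE `k(w₀)`: derivative with the norm floor `κ₀`
# for EVERY `Σcᵢ ≤ 1`, the log-ball condition supplied by part 29A's 1-Lipschitz bound

WIDTH SEAT `pub-ymgap-dag-n08-w3` g5, `W-SEAT-START-LIST.md` §0 (iii); item-3 lineage part 29B = located item (i) of `N08-HK-CORE-SU2.md` §3 (range extension), the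
consumer of part 29A `…GuardTangentDictionary`, 2026-08-28.  DAG node N08 = [Balaban1985UV3] Thm 1 p. 257 + Thm 2 p. 272; [Balaban1987RG1] (0.4) p. 253; key item K1⁷
`StabilityBAtRecordR13SepCoPH` (stmt-QuantumFields-20542, `aside`), `--supports … --as helper`.  COUNT-NEUTRAL.  Consumed by part 29C `…GuardCoreLawSU2Wide`.

WHAT THIS FILE PROVES (theorems only, 0 def; [folklore] calculus in pub-balaban's quaternion model; parts 26A–29A of this lineage BY IMPORT):
 ★★ `exists_hasFDerivAt_chart_of_target`: part 27B's `exists_hasFDerivAt_chart` with the target chart centred at an ARBITRARY unit `z` — for unit `aᵢ`, `cᵢ ≥ 0`, `Σcᵢ ≤ 1`,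
    units `u₀, z`, `‖A‖ < π∕3`, `w = u₀e^{ι(rev A)}` in the guard `‖aᵢw̄ − 1‖ < 1∕2` and `v = z̄·k(w)` in the log ball `‖v − 1‖ < 1` (HYPOTHESIS): the conjugate
    `ψ(A) = rev(imVec(qlog(z̄·k(u₀e^{ι(rev A)}))))` has a Fréchet derivative `D` at `A` with `κ₀‖h‖ ≤ ‖D h‖`, `κ₀ = (1 − Σcᵢ)·sin 1·(sin(π∕3)∕(π∕3))` (same proof).
 ★ `chart_conj_of_target`: `z·e^{ι(rev(ψ A))} = k(w)`, `‖ψ A‖ < π∕3`.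
 ★★ `norm_target_kf_sub_one_le`: **THE LOG-BALL CONDITION FOR `z = k(u₀)` FOR EVERY `Σcᵢ ≤ 1`** — `‖k(u₀)⁻·k(w) − 1‖ = ‖k(w) − k(u₀)‖ ≤ ‖A‖` (29A `norm_kf_sub_kf_le_of_guard`,
    i.e. n08-w6's hs-contraction integrated along the guarded geodesic).
 `norm_lt_of_chord`: on the window (`‖w − u₀‖ < 2∕3`, `‖A‖ < π∕3`) `‖A‖ < 7∕10` (`2 sin(‖A‖∕2) = ‖w − u₀‖`, `1∕3 ≤ sin(7∕20)`) — so the hypothesis above holds.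
HONEST FRAMING: quaternion-level lemmas; assembly in part 29C; the record's block sizes (`8 ≤ θ.L`) are NOT covered by this route; E6′ NOT decided; count-neutral;
N08 NOT discharged; counts unmoved (typed 28∕28 · discharged 5∕27); R4 closes the CONDITIONAL rung `BalabanLadder.UV` only; the Yang–Mills mass gap (Clay) is NOT proved;
nothing continuum ∕ OS.  0 `sorry`, standard axioms.
-/

noncomputable section

open NormedSpace Set Metric Function Filter MeasureTheory
open scoped RealInnerProductSpace Topology Quaternion ENNReal

namespace Summit.QuantumFields.YangMills.BalabanUVNodes.N08HaarCompatibilityGuardCoreChartTarget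

open Literature.MathematicalPhysics.QuantumFieldTheory (haarProbability)
open Literature.MathematicalPhysics.QuantumFieldTheory.Balaban1983to89
open Literature.MathematicalPhysics.QuantumFieldTheory.Balaban1983to89.T4QuatExpLog
open Literature.MathematicalPhysics.QuantumFieldTheory.Balaban1983to89.T4EMLFibreAC
open Literature.MathematicalPhysics.QuantumFieldTheory.Balaban1983to89.T4HaarSU2ExpChart (imQuat imQuat_re norm_imQuat expPoint
  su2Quat_expPoint injOn_expPoint)
open Literature.MathematicalPhysics.QuantumFieldTheory.Balaban1983to89.T4ExpWindowSmallField (imVec imQuat_imVec norm_imVec_sq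
  dist1_eq_norm_su2Quat_sub_one)
open Literature.MathematicalPhysics.QuantumFieldTheory.Balaban1983to89.B15Prop1ChartCalculusSU2 (imVecL imVecL_apply imVec_imQuat)
open Literature.MathematicalPhysics.QuantumFieldTheory.Balaban1983to89.B10Eq18SigmaSU2Haar (rev rev_rev norm_rev expPauli expPauli_eq_expPoint)
open Literature.MathematicalPhysics.QuantumFieldTheory.Balaban1983to89.B10Eq22Rescaling (sigmaSU2)
open Literature.MathematicalPhysics.QuantumLattice (quatMatrix su2Quat norm_su2Quat quatToSU2 quatToSU2_su2Quat quatMatrix_su2Quat)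
open Literature.MathematicalPhysics.QuantumFieldTheory.Balaban1983to89.T4HaarSU2Translate (su2Quat_mul haarData_haar_eq)
open Summit.QuantumFields.YangMills.BalabanUVNodes.N08HaarCompatibilityGuardGeodesics
open Summit.QuantumFields.YangMills.BalabanUVNodes.N08HaarCompatibilityGuardCoreInjective
open Summit.QuantumFields.YangMills.BalabanUVNodes.N08HaarCompatibilityGuardChartLift
open Summit.QuantumFields.YangMills.BalabanUVNodes.N08HaarCompatibilityGuardCoreChart
open Summit.QuantumFields.YangMills.BalabanUVNodes.N08HaarCompatibilityGuardTangentDictionary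

/-! ## §1 The chart conjugate with an arbitrary unit target centre -/

section Quat

variable {ι : Type*} [Fintype ι]

/-- ★★ **THE CHART CONJUGATE WITH AN ARBITRARY UNIT TARGET CENTRE `z`, AND ITS DERIVATIVE WITH A NORM FLOOR.**  For unit `aᵢ`, `cᵢ ≥ 0` with `Σcᵢ ≤ 1`, units `u₀, z`,
and `A ∈ ℝ³` with `‖A‖ < π∕3` such that `w = u₀·e^{ι(rev A)}` is in the guard `‖aᵢw̄ − 1‖ < 1∕2` and `v = z̄·k(w)` is in the log ball `‖v − 1‖ < 1`, the chart conjugate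
`ψ(A) = rev(imVec(qlog(z̄·k(u₀ e^{ι(rev A)}))))` has a Fréchet derivative `D` at `A` with **`κ₀‖h‖ ≤ ‖D h‖`** (part 27B's proof verbatim with `ū₀ ↦ z̄`),
`κ₀ = (1 − Σcᵢ)·sin 1·(sin(π∕3)∕(π∕3))` (chain rule; lower singular values `sinc‖ιA‖ ≥ sinc(π∕3)` of `D exp`, `(1 − Σcᵢ)sinc‖Y‖ ≥ (1 − Σcᵢ) sin 1` of
`k′` (part 27A `exists_kD_mul_eq`), `1` of `D qlog` (`norm_le_norm_N`); left translations, `ι = imQuat∘rev` and `rev∘imVec` are isometric on the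
relevant imaginary vectors). [folklore] -/
theorem exists_hasFDerivAt_chart_of_target {a : ι → ℍ} (c : ι → ℝ) {u₀ z : ℍ} (hu₀ : ‖u₀‖ = 1) (hz : ‖z‖ = 1) (ha : ∀ i, ‖a i‖ = 1) (hc : ∀ i, 0 ≤ c i)
    (hs1 : ∑ i, c i ≤ 1) {A : EuclideanSpace ℝ (Fin 3)} (hA : ‖A‖ < Real.pi / 3)
    (hg2 : ∀ i, ‖a i * star (u₀ * exp (imQuat (rev A))) - 1‖ < 1 / 2)
    (hv : ‖star z * kf a c (u₀ * exp (imQuat (rev A))) - 1‖ < 1) :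
    ∃ D : EuclideanSpace ℝ (Fin 3) →L[ℝ] EuclideanSpace ℝ (Fin 3),
      HasFDerivAt (fun A : EuclideanSpace ℝ (Fin 3) => rev (imVec (qlog (star z * kf a c (u₀ * exp (imQuat (rev A))))))) D A ∧
      ∀ h, ((1 - ∑ i, c i) * Real.sin 1 * (Real.sin (Real.pi / 3) / (Real.pi / 3))) * ‖h‖ ≤ ‖D h‖ := by
  set B : ℍ := imQuat (rev A) with hB_def
  set w : ℍ := u₀ * exp B with hw_def
  set v : ℍ := star z * kf a c w with hv_def
  have hBre : B.re = 0 := imQuat_re _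
  have hBn : ‖B‖ = ‖A‖ := by rw [hB_def, norm_imQuat, norm_rev]
  have hw1 : ‖w‖ = 1 := by rw [hw_def, norm_mul, hu₀, norm_exp_of_re_eq_zero hBre, mul_one]
  have hg1 : ∀ i, ‖a i * star w - 1‖ < 1 := fun i => (hg2 i).trans (by norm_num)
  have hYre : (Yf a c w).re = 0 := Yf_re_eq_zero c hw1 ha hc hs1 hg2
  have hv1 : ‖v‖ = 1 := by
    rw [hv_def, norm_mul, Quaternion.norm_star, hz, one_mul, kf, norm_mul, norm_exp_of_re_eq_zero hYre, hw1, mul_one]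
  -- the chain of derivatives
  set I : EuclideanSpace ℝ (Fin 3) →L[ℝ] ℍ := (imQuat.toContinuousLinearMap).comp (rev.toContinuousLinearEquiv : EuclideanSpace ℝ (Fin 3) →L[ℝ] EuclideanSpace ℝ (Fin 3)) with hI_def
  have hI : ∀ h, I h = imQuat (rev h) := fun h => rfl
  have hIder : HasFDerivAt (fun A : EuclideanSpace ℝ (Fin 3) => imQuat (rev A)) I A := by
    have := I.hasFDerivAt (x := A)
    exact this
  have hE : HasFDerivAt (fun A : EuclideanSpace ℝ (Fin 3) => u₀ * exp (imQuat (rev A)))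
      ((ContinuousLinearMap.mul ℝ ℍ u₀).comp ((fderiv ℝ exp B).comp I)) A := by
    have h1 := (hasFDerivAt_exp B).comp A hIder
    exact h1.const_mul u₀
  have hK : HasFDerivAt (kf a c) (kD a c w) w := (hasStrictFDerivAt_kf c hg1).hasFDerivAt
  have hKE := hK.comp A hE
  have hV : HasFDerivAt (fun A : EuclideanSpace ℝ (Fin 3) => star z * kf a c (u₀ * exp (imQuat (rev A))))
      ((ContinuousLinearMap.mul ℝ ℍ (star z)).comp ((kD a c w).comp ((ContinuousLinearMap.mul ℝ ℍ u₀).comp ((fderiv ℝ exp B).comp I)))) A :=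
    hKE.const_mul (star z)
  have hL : HasFDerivAt qlog (fderiv ℝ qlog v) v := hasFDerivAt_qlog hv
  have hLV := hL.comp A hV
  set P : ℍ →L[ℝ] EuclideanSpace ℝ (Fin 3) := (rev.toContinuousLinearEquiv : EuclideanSpace ℝ (Fin 3) →L[ℝ] EuclideanSpace ℝ (Fin 3)).comp imVecL with hP_def
  have hP : ∀ q, P q = rev (imVec q) := fun q => rfl
  have hfull := P.hasFDerivAt.comp A hLV
  refine ⟨P.comp ((fderiv ℝ qlog v).comp ((ContinuousLinearMap.mul ℝ ℍ (star z)).comp ((kD a c w).comp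
    ((ContinuousLinearMap.mul ℝ ℍ u₀).comp ((fderiv ℝ exp B).comp I))))), hfull, ?_⟩
  -- the norm floor
  intro h
  set x : ℍ := imQuat (rev h) with hx_def
  have hxre : x.re = 0 := imQuat_re _
  have hxn : ‖x‖ = ‖h‖ := by rw [hx_def, norm_imQuat, norm_rev]
  -- step 1: `D exp(B) x = e^B y₁`, `y₁` imaginary, `‖y₁‖ ≥ sinc‖B‖·‖x‖`
  set t₁ : ℍ := fderiv ℝ exp B x with ht₁_def
  set y₁ : ℍ := exp (-B) * t₁ with hy₁_def
  have hy₁re : y₁.re = 0 := re_exp_neg_mul_fderiv_exp hBre hxre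
  have ht₁ : t₁ = exp B * y₁ := by rw [hy₁_def, ← mul_assoc, exp_mul_exp_neg, one_mul]
  have hy₁n : |Real.sinc ‖B‖| * ‖x‖ ≤ ‖y₁‖ := by
    have : ‖y₁‖ = ‖t₁‖ := by
      have hnB : (-B).re = 0 := by rw [Quaternion.re_neg, hBre, neg_zero]
      rw [hy₁_def, norm_mul, norm_exp_of_re_eq_zero hnB, one_mul]
    rw [this]; exact abs_sinc_mul_norm_le_norm_fderiv_exp hBre hxre
  -- step 2: `k′(w)(w y₁) = k(w) y₂`
  obtain ⟨y₂, hy₂re, hy₂, hy₂n⟩ := exists_kD_mul_eq c hw1 ha hc hs1 hg2 hy₁re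
  -- step 3: `D qlog(v)(v y₂) = N_{qlog v} y₂`
  have hq := fderiv_qlog_apply_mul_of_lt_one hv1 hv hy₂re
  have hZre : (qlog v).re = 0 := qlog_re_of_norm_eq_one hv1 hv
  have hZπ : ‖qlog v‖ < Real.pi := (norm_qlog_lt_pi_div_three hv1 hv).trans (by linarith [Real.pi_gt_three])
  have hNre : (N (qlog v) y₂).re = 0 := N_re hZre hy₂re
  -- the composite applied to `h`
  have hcomp : (P.comp ((fderiv ℝ qlog v).comp ((ContinuousLinearMap.mul ℝ ℍ (star z)).comp ((kD a c w).comp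
      ((ContinuousLinearMap.mul ℝ ℍ u₀).comp ((fderiv ℝ exp B).comp I)))))) h = rev (imVec (N (qlog v) y₂)) := by
    simp only [ContinuousLinearMap.comp_apply, ContinuousLinearMap.mul_apply', hI, hP]
    rw [← hx_def, ← ht₁_def, ht₁, ← mul_assoc, ← hw_def, hy₂, ← mul_assoc, ← hv_def, hq]
  rw [hcomp, norm_rev, norm_imVec_of_re_eq_zero hNre]
  -- collect the floors
  have hN : ‖y₂‖ ≤ ‖N (qlog v) y₂‖ := norm_le_norm_N hZre hy₂re hZπ
  have hsl : 0 ≤ 1 - ∑ i, c i := by linarith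
  -- `sinc‖Y‖ ≥ sin 1` and `|sinc‖B‖| ≥ sin(π/3)/(π/3)`
  have hY1 : ‖Yf a c w‖ ≤ 1 := by
    rw [Yf]
    refine (norm_sum_le _ _).trans ((Finset.sum_le_sum fun i _ => ?_).trans hs1)
    rw [norm_smul, Real.norm_of_nonneg (hc i)]
    exact (mul_le_mul_of_nonneg_left (norm_qlog_lt_one (hg2 i)).le (hc i)).trans_eq (mul_one _)
  have hsincY : Real.sin 1 ≤ Real.sinc ‖Yf a c w‖ := by
    rcases eq_or_ne ‖Yf a c w‖ 0 with h0 | h0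
    · rw [h0, Real.sinc_zero]; exact Real.sin_le_one 1
    · rw [Real.sinc_of_ne_zero h0]
      have hpos : 0 < ‖Yf a c w‖ := (norm_nonneg _).lt_of_ne' h0
      have := N08HaarCompatibilityGuardJacobian.sin_div_le_sin_div hpos hY1 (by linarith [Real.pi_gt_three])
      simpa using this
  have hsincB : Real.sin (Real.pi / 3) / (Real.pi / 3) ≤ |Real.sinc ‖B‖| := by
    rw [hBn]
    rcases eq_or_ne ‖A‖ 0 with h0 | h0
    · rw [h0, Real.sinc_zero, abs_one]
      exact (div_le_one (by positivity)).2 ((Real.sin_le (by positivity)).trans le_rfl)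
    · have hpos : 0 < ‖A‖ := (norm_nonneg _).lt_of_ne' h0
      rw [Real.sinc_of_ne_zero h0, abs_of_nonneg (div_nonneg (Real.sin_nonneg_of_nonneg_of_le_pi hpos.le (by linarith [Real.pi_gt_three])) hpos.le)]
      exact N08HaarCompatibilityGuardJacobian.sin_div_le_sin_div hpos hA.le (by linarith [Real.pi_gt_three])
  have hsin1 : 0 ≤ Real.sin 1 := Real.sin_nonneg_of_nonneg_of_le_pi zero_le_one (by linarith [Real.pi_gt_three])
  have hsin3 : 0 ≤ Real.sin (Real.pi / 3) / (Real.pi / 3) :=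
    div_nonneg (Real.sin_nonneg_of_nonneg_of_le_pi (by positivity) (by linarith [Real.pi_gt_three])) (by positivity)
  calc (1 - ∑ i, c i) * Real.sin 1 * (Real.sin (Real.pi / 3) / (Real.pi / 3)) * ‖h‖
      ≤ (1 - ∑ i, c i) * Real.sinc ‖Yf a c w‖ * |Real.sinc ‖B‖| * ‖h‖ :=
        mul_le_mul_of_nonneg_right (mul_le_mul (mul_le_mul_of_nonneg_left hsincY hsl) hsincB hsin3
          (mul_nonneg hsl (hsin1.trans hsincY))) (norm_nonneg h)
    _ = (1 - ∑ i, c i) * Real.sinc ‖Yf a c w‖ * (|Real.sinc ‖B‖| * ‖x‖) := by rw [hxn]; ring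
    _ ≤ (1 - ∑ i, c i) * Real.sinc ‖Yf a c w‖ * ‖y₁‖ := by
        have : 0 ≤ (1 - ∑ i, c i) * Real.sinc ‖Yf a c w‖ := mul_nonneg hsl (hsin1.trans hsincY)
        exact mul_le_mul_of_nonneg_left hy₁n this
    _ ≤ ‖y₂‖ := hy₂n
    _ ≤ ‖N (qlog v) y₂‖ := hN


/-- ★ **THE CONJUGACY AND THE RANGE for the target centre `z`**: with `v = z̄·k(w)` in the log ball, `z·e^{ι(rev(ψ A))} = k(w)` and `‖ψ A‖ < π∕3`. [folklore] -/
theorem chart_conj_of_target {a : ι → ℍ} (c : ι → ℝ) {z w : ℍ} (hz : ‖z‖ = 1) (hv1 : ‖star z * kf a c w‖ = 1) (hv : ‖star z * kf a c w - 1‖ < 1) :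
    z * exp (imQuat (rev (rev (imVec (qlog (star z * kf a c w)))))) = kf a c w ∧ ‖rev (imVec (qlog (star z * kf a c w)))‖ < Real.pi / 3 := by
  have hZre : (qlog (star z * kf a c w)).re = 0 := qlog_re_of_norm_eq_one hv1 hv
  have hzs : z * star z = 1 := by rw [Quaternion.self_mul_star, Quaternion.normSq_eq_norm_mul_self, hz]; simp
  refine ⟨?_, ?_⟩
  · rw [rev_rev, imQuat_imVec_of_re_eq_zero hZre, exp_qlog hv, ← mul_assoc, hzs, one_mul]
  · rw [norm_rev, norm_imVec_of_re_eq_zero hZre]; exact norm_qlog_lt_pi_div_three hv1 hv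

/-- ★★ **THE LOG-BALL CONDITION FOR THE CENTRE `z = k(u₀)`, FOR EVERY `Σcᵢ ≤ 1`**: for a unit `u₀` in the chordal guard `‖aᵢ − u₀‖ < δ` (`δ ≤ 1∕2`) and `A` with `‖A‖ < π∕3`
such that `w = u₀ e^{ι(rev A)}` is also in the guard: `v = k(u₀)⁻·k(w)` is a unit with `‖v − 1‖ ≤ ‖A‖` (part 29A `norm_kf_sub_kf_le_of_guard`) — hence `< 1` as soon
as `‖A‖ < 1`, which holds on the window (`2 sin(‖A‖∕2) = ‖w − u₀‖ < 2δ ≤ 2∕3`). [folklore] -/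
theorem norm_target_kf_sub_one_le {a : ι → ℍ} (c : ι → ℝ) {u₀ : ℍ} (hu₀ : ‖u₀‖ = 1) (ha : ∀ i, ‖a i‖ = 1) (hc : ∀ i, 0 ≤ c i) (hs1 : ∑ i, c i ≤ 1)
    {δ : ℝ} (hδ : δ ≤ 1 / 2) {A : EuclideanSpace ℝ (Fin 3)} (hA : ‖A‖ < Real.pi / 3) (h0 : ∀ i, ‖a i - u₀‖ < δ)
    (h1 : ∀ i, ‖a i - u₀ * exp (imQuat (rev A))‖ < δ) :
    ‖star (kf a c u₀) * kf a c (u₀ * exp (imQuat (rev A)))‖ = 1 ∧ ‖star (kf a c u₀) * kf a c (u₀ * exp (imQuat (rev A))) - 1‖ ≤ ‖A‖ := by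
  set x : ℍ := imQuat (rev A) with hx_def
  have hxre : x.re = 0 := imQuat_re _
  have hxn : ‖x‖ = ‖A‖ := by rw [hx_def, norm_imQuat, norm_rev]
  have hxπ : ‖x‖ < Real.pi := by rw [hxn]; linarith [Real.pi_gt_three]
  have hw1 : ‖u₀ * exp x‖ = 1 := by rw [norm_mul, hu₀, norm_exp_of_re_eq_zero hxre, mul_one]
  have hg0 : ∀ i, ‖a i * star u₀ - 1‖ < 1 / 2 := fun i => by rw [norm_mul_star_sub_one hu₀]; exact (h0 i).trans_le hδ
  have hgw : ∀ i, ‖a i * star (u₀ * exp x) - 1‖ < 1 / 2 := fun i => by rw [norm_mul_star_sub_one hw1]; exact (h1 i).trans_le hδ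
  have hY0 : (Yf a c u₀).re = 0 := Yf_re_eq_zero c hu₀ ha hc hs1 hg0
  have hYw : (Yf a c (u₀ * exp x)).re = 0 := Yf_re_eq_zero c hw1 ha hc hs1 hgw
  have hk0 : ‖kf a c u₀‖ = 1 := by rw [kf, norm_mul, norm_exp_of_re_eq_zero hY0, hu₀, mul_one]
  have hkw : ‖kf a c (u₀ * exp x)‖ = 1 := by rw [kf, norm_mul, norm_exp_of_re_eq_zero hYw, hw1, mul_one]
  have hss : star (kf a c u₀) * kf a c u₀ = 1 := by rw [Quaternion.star_mul_self, Quaternion.normSq_eq_norm_mul_self, hk0]; simp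
  refine ⟨by rw [norm_mul, Quaternion.norm_star, hk0, hkw, one_mul], ?_⟩
  have h : star (kf a c u₀) * kf a c (u₀ * exp x) - 1 = star (kf a c u₀) * (kf a c (u₀ * exp x) - kf a c u₀) := by rw [mul_sub, hss]
  rw [h, norm_mul, Quaternion.norm_star, hk0, one_mul, ← hxn]
  exact norm_kf_sub_kf_le_of_guard c ha hc hs1 hδ hu₀ hxre hxπ h0 h1

/-- On the window the chart coordinate is short: `‖w − u₀‖ < 2∕3` with `w = u₀e^{ι(rev A)}`, `‖A‖ < π∕3` ⇒ `‖A‖ < 7∕10` (`2 sin(‖A‖∕2) < 2∕3`, `1∕3 ≤ sin(7∕20)`). [folklore] -/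
theorem norm_lt_of_chord {u₀ : ℍ} (hu₀ : ‖u₀‖ = 1) {A : EuclideanSpace ℝ (Fin 3)} (hA : ‖A‖ < Real.pi / 3) (hwu : ‖u₀ * exp (imQuat (rev A)) - u₀‖ < 2 / 3) :
    ‖A‖ < 7 / 10 := by
  have hxre : (imQuat (rev A)).re = 0 := imQuat_re _
  have hch : ‖u₀ * exp (imQuat (rev A)) - u₀‖ = 2 * |Real.sin (‖A‖ / 2)| := by
    rw [show u₀ * exp (imQuat (rev A)) - u₀ = u₀ * (exp (imQuat (rev A)) - 1) by rw [mul_sub, mul_one], norm_mul, hu₀, one_mul,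
      norm_exp_sub_one_eq hxre, norm_imQuat, norm_rev]
  rw [hch, abs_of_nonneg (Real.sin_nonneg_of_nonneg_of_le_pi (by positivity) (by linarith [Real.pi_gt_three]))] at hwu
  have hsin : (1 / 3 : ℝ) ≤ Real.sin (7 / 20) := by
    have := Real.sin_gt_sub_cube (show (0:ℝ) < 7/20 by norm_num); nlinarith
  by_contra hle
  have hle : 7 / 20 ≤ ‖A‖ / 2 := by linarith [not_lt.1 hle]
  have := Real.sin_le_sin_of_le_of_le_pi_div_two (by linarith) (by linarith [Real.pi_gt_three]) hle
  linarith

end Quat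

end Summit.QuantumFields.YangMills.BalabanUVNodes.N08HaarCompatibilityGuardCoreChartTarget

end
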